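import Summits.QuantumFields.YangMills.Theorems.LuscherReductionTwistedTraceScalingBOLocalisedAvgSlice
import Summits.QuantumFields.YangMills.Theorems.LuscherReductionTwistedTraceScalingBTWindow
import HarnessLib

/-!
# (C1c'-η) THE INDICATOR FACTS ON THE CHART CORE: along the based orbit of a slice tube point the configuration stays in the fat tube and in the orthographic tube, its slow mean stays near `1`
# with one-site action `O(ρ⁴)`, and its relative coordinate has norm `≤ ‖x*‖ + D`
# (lane A of S-BASE, crux `TwistedTraceScaling` stmt-QuantumFields-20203, C4-CORE, the (OD) pen; item (ind) of `pub/ym-fleet/ym-luscher-20007-p1/COARSE-DESIGN.md` §28.5)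

The lower half of `…BOLocalisedAvgSlice.localisedAvg_slice_bounds` asks, for every chart point `w` of the Gaussian core `‖w‖ ≤ r`, three facts about `U_w = (tubePt p)^{basedExt(gno∘w)}`:
orthographic-tube membership, a lower bound on `χ₀(slowMean U_w)` (for the window indicator: `slowMean U_w` in the window), and `‖relLinkVec U_w‖ ≤ r_f β`.  Here:
* §1 `norm_su2Quat_sub_one_sq` (`‖q(A) − 1‖² = (s−1)² + Σ_c v_c²`), ★ `norm_su2Quat_slowMean_sub_one_le` — for `U ∈ nearOne ρ₀` with `ρ₀ ≤ 1/4`: `‖q(slowMean U_k) − 1‖ ≤ 5ρ₀` for every direction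
  (`polarMean_near` with `τ = ρ₀²/4`) and hence `S₁(slowMean U) ≤ 12·(5ρ₀)⁴` (`…BTWindow.wilsonAction_one_site_le`);
* §2 ★★ `slice_core_indicator_facts` — under the hypotheses of `fpWeight_laplace_bounds` (tube point `tubePt p ∈ fatTubeRho δ (ρ₁) β`, `ρ₁ + 8r ≤ ρ β`, `ρ β ≤ 1/4`, Taylor data `hT`): for `‖w‖ ≤ r`,
  `U_w ∈ fatTubeRho δ ρ β`, `U_w ∈ orthoTubeSet`, `‖q(slowMean U_w k) − 1‖ ≤ 5ρ β`, `S₁(slowMean U_w) ≤ 12(5ρ β)⁴`, `‖relLinkVec U_w‖ ≤ ‖linkEmbed p.1‖ + ‖basedLin p‖r + Mr²`.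
HONEST FRAMING: bookkeeping for a stub of a child of the CONDITIONAL route R2b1; (C1c') (4'),(5),(rates), (C4), (C5), (B-ST) OPEN; C4-CORE OPEN; not infinite volume, not a gap, not Clay.
-/

set_option autoImplicit false

noncomputable section

open MeasureTheory Real
open scoped BigOperators RealInnerProductSpace Quaternion
open Literature.MathematicalPhysics.QuantumFieldTheory
open Literature.MathematicalPhysics.QuantumLattice

namespace Summit.QuantumFields.YangMills.Theorems.FemtoTransferGap.TwoLattice.ConstTube

open Summit.QuantumFields.YangMills.Theorems.FemtoTransferGap
open Summit.QuantumFields.YangMills.Theorems.FemtoTransferGap.TwoLattice.Avg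
open Summit.QuantumFields.YangMills.Theorems.FemtoTransferGap.TwoLattice.Stiff (LinkSpace)
open Summit.QuantumFields.YangMills.Theorems.FemtoTransferGap.TwoLattice.GnChart
open Summit.QuantumFields.YangMills.Theorems.FemtoTransferGap.TwoLattice.Chart (one_sub_scalarPart_le)
open Literature.MathematicalPhysics.QuantumFieldTheory.Balaban1983to89.T4CubeChartGnomonic (gnoPoint)

variable {L : ℕ} [NeZero L]

/-! ## §1 The slow mean of a near-vacuum configuration -/

/-- `‖q(A) − 1‖² = (scalarPart A − 1)² + Σ_c vecPart A c²`. [folklore] -/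
theorem norm_su2Quat_sub_one_sq (A : SU2) : ‖su2Quat A - 1‖ ^ 2 = (scalarPart A - 1) ^ 2 + ∑ c, vecPart A c ^ 2 := by
  rw [sq (‖su2Quat A - 1‖), ← Quaternion.normSq_eq_norm_mul_self, Quaternion.normSq_def']
  simp only [Quaternion.re_sub, Quaternion.imI_sub, Quaternion.imJ_sub, Quaternion.imK_sub, Quaternion.re_one, Quaternion.imI_one, Quaternion.imJ_one,
    Quaternion.imK_one, sub_zero, Fin.sum_univ_three, vecPart, scalarPart, Matrix.cons_val_zero, Matrix.cons_val_one, Matrix.cons_val]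
  ring

/-- ★ **The slow mean of a near-vacuum configuration is near `1`**: for `U ∈ nearOne ρ₀`, `0 ≤ ρ₀ ≤ 1/4`, every direction `k` has `‖q(slowMean U (0,k)) − 1‖ ≤ 5ρ₀`, and the one-site action of
the slow mean is `≤ 12(5ρ₀)⁴`. [folklore] -/
theorem norm_su2Quat_slowMean_sub_one_le {U : GaugeConfig 3 L SU2} {ρ₀ : ℝ} (hρ0 : 0 ≤ ρ₀) (hρ4 : ρ₀ ≤ 1 / 4) (hU : U ∈ nearOne L ρ₀) :
    (∀ k : Fin 3, ‖su2Quat (slowMean L U (0, k)) - 1‖ ≤ 5 * ρ₀) ∧ wilsonAction su2Rep (slowMean L U) ≤ 12 * (5 * ρ₀) ^ 4 := by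
  -- `1 − ρ₀²/4 ≤ scalarPart (U e)`
  have hτ0 : 0 ≤ ρ₀ ^ 2 / 4 := by positivity
  have hτ : ρ₀ ^ 2 / 4 ≤ 1 / 2 := by nlinarith
  have hUs : ∀ e : Edge 3 L, 1 - ρ₀ ^ 2 / 4 ≤ scalarPart (U e) := fun e => scalarPart_ge_of_frobNorm_le (hU e).le
  have hk : ∀ k : Fin 3, ‖su2Quat (slowMean L U (0, k)) - 1‖ ≤ 5 * ρ₀ := by
    intro k
    obtain ⟨hs, hv⟩ := polarMean_near L hτ0 hτ hUs k
    have hsqrt : Real.sqrt (2 * (ρ₀ ^ 2 / 4)) ≤ ρ₀ := by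
      rw [Real.sqrt_le_left hρ0]; nlinarith
    set pk := polarMean L k U with hpk
    have hva : ∀ a, |vecPart pk a| ≤ 2 * ρ₀ := fun a => by
      have h1 := norm_le_pi_norm (vecPart pk) a
      rw [Real.norm_eq_abs] at h1
      exact h1.trans (hv.trans (by linarith))
    have hsum : ∑ a, vecPart pk a ^ 2 ≤ 12 * ρ₀ ^ 2 := by
      calc ∑ a, vecPart pk a ^ 2 ≤ ∑ _a : Fin 3, (2 * ρ₀) ^ 2 := Finset.sum_le_sum fun a _ => by rw [← sq_abs]; exact pow_le_pow_left₀ (abs_nonneg _) (hva a) 2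
        _ = 12 * ρ₀ ^ 2 := by simp; ring
    obtain ⟨h0, h1⟩ := one_sub_scalarPart_le pk hs
    have hs1 : scalarPart pk ≤ 1 := by linarith
    have hsq : ‖su2Quat pk - 1‖ ^ 2 ≤ (5 * ρ₀) ^ 2 := by
      rw [norm_su2Quat_sub_one_sq]
      have h2 : (scalarPart pk - 1) ^ 2 ≤ 1 - scalarPart pk := by nlinarith
      have h3 : (scalarPart pk - 1) ^ 2 + ∑ c, vecPart pk c ^ 2 ≤ 24 * ρ₀ ^ 2 := by linarith
      nlinarith
    have hslow : slowMean L U (0, k) = pk := rfl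
    rw [hslow]
    exact (pow_le_pow_iff_left₀ (norm_nonneg _) (by positivity) two_ne_zero).1 hsq
  refine ⟨hk, wilsonAction_one_site_le (slowMean L U) fun e => ?_⟩
  show ‖su2Quat (polarMean L e.2 U) - 1‖ ≤ 5 * ρ₀
  exact hk e.2

/-! ## §2 ★★ The indicator facts on the chart core -/

/-- ★★ **Indicator facts on the chart core of a slice tube point.**  Hypotheses: the fat-tube membership `tubePt p ∈ fatTubeRho δ (ρ₁) β` and `ρ₁ + 8r ≤ ρ β ≤ 1/4`, the Taylor datum `hT` with
`‖p‖ < ε_T`, `‖p‖ ≤ 1/40`, `r < ε_T`.  Then for every chart point `‖w‖ ≤ r`, with `U_w = (tubePt p)^{basedExt(gno∘w)}`:  `U_w ∈ fatTubeRho δ ρ β`, `U_w ∈ orthoTubeSet`,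
`‖q(slowMean U_w (0,k)) − 1‖ ≤ 5ρ β` (all `k`), `S₁(slowMean U_w) ≤ 12(5ρ β)⁴`, `‖relLinkVec U_w‖ ≤ ‖linkEmbed p.1‖ + (‖basedLin p‖·r + M·r²)`. [folklore] -/
theorem slice_core_indicator_facts {δ ρ : ℝ → ℝ} {β : ℝ} (p : balancedSubmodule L × (Fin 3 → Fin 3 → ℝ))
    {εT M : ℝ} (hM0 : 0 ≤ M)
    (hT : ∀ (ξ : basedSubmodule L) (q : balancedSubmodule L × (Fin 3 → Fin 3 → ℝ)), ‖ξ‖ < εT → ‖q‖ < εT →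
      ‖basedFn L (ξ, q) - basedFn L (0, q) - basedLin L q ξ‖ ≤ M * ‖ξ‖ ^ 2)
    (hpT : ‖p‖ < εT) (hp40 : ‖p‖ ≤ 1 / 40)
    {ρ₁ : ℝ} (hU : tubePt L p ∈ fatTubeRho L δ (fun _ => ρ₁) β)
    {r : ℝ} (hr0 : 0 ≤ r) (hrT : r < εT) (hr2 : r ≤ 1 / 2) (hcore : ρ₁ + 8 * r ≤ ρ β) (hρ4 : ρ β ≤ 1 / 4)
    {w : NzSite L → Fin 3 → ℝ} (hw : ‖w‖ ≤ r) :
    gaugeTransform (basedExt L fun y => gnoPoint (w y)) (tubePt L p) ∈ fatTubeRho L δ ρ β ∧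
      gaugeTransform (basedExt L fun y => gnoPoint (w y)) (tubePt L p) ∈ orthoTubeSet L ∧
      (∀ k : Fin 3, ‖su2Quat (slowMean L (gaugeTransform (basedExt L fun y => gnoPoint (w y)) (tubePt L p)) (0, k)) - 1‖ ≤ 5 * ρ β) ∧
      wilsonAction su2Rep (slowMean L (gaugeTransform (basedExt L fun y => gnoPoint (w y)) (tubePt L p))) ≤ 12 * (5 * ρ β) ^ 4 ∧
      ‖relLinkVec L (gaugeTransform (basedExt L fun y => gnoPoint (w y)) (tubePt L p))‖ ≤ ‖linkEmbed L (p.1 : Edge 3 L → Fin 3 → ℝ)‖ + (‖basedLin L p‖ * r + M * r ^ 2) := by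
  set Uw := gaugeTransform (basedExt L fun y => gnoPoint (w y)) (tubePt L p) with hUw
  have hρ0 : 0 ≤ ρ β := by
    have h1 : 0 ≤ ρ₁ := (frobNorm_nonneg _).trans (hU.1 default).le
    linarith
  -- (1) fat tube
  have hfat : Uw ∈ fatTubeRho L δ ρ β := by
    rw [hUw, basedExt_gno_eq]
    have hG' : ∀ x, ‖(gnoParam L w : Site 3 L → Fin 3 → ℝ) x‖ ≤ r := fun x =>
      (norm_le_pi_norm _ x).trans ((norm_gnoParam_le L w).trans hw)
    exact gaugeTransform_chart_mem_fatTubeRho L (ρ := fun _ => ρ₁) hU hG' hr2 (by simpa using hcore)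
  have hnear : Uw ∈ nearOne L (ρ β) := hfat.1
  -- (2) orthographic tube
  have hδ' : ∀ e : Edge 3 L, 1 - ρ β ^ 2 / 4 ≤ scalarPart (Uw e) := fun e => scalarPart_ge_of_frobNorm_le (hnear e).le
  have htube : Uw ∈ orthoTubeSet L := (mem_orthoTubeSet_of_near_one L (by positivity) (by nlinarith) hδ').2.1
  -- (3) slow mean
  obtain ⟨hk, hS⟩ := norm_su2Quat_slowMean_sub_one_le hρ0 hρ4 hnear
  -- (4) relative coordinate
  have hx : relLinkVec L Uw = basedFn L (gnoParam L w, p) := by rw [hUw, basedExt_gno_eq, relLinkVec_gaugeTransform_tubePt]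
  have hξr : ‖gnoParam L w‖ ≤ r := (norm_gnoParam_le L w).trans hw
  have hp1 : ‖p.1‖ ≤ 1 / 20 := (norm_fst_le p).trans (by linarith)
  have hp2 : ‖p.2‖ ≤ 1 / 40 := (norm_snd_le p).trans hp40
  have hfB0 : basedFn L (0, p) = linkEmbed L (p.1 : Edge 3 L → Fin 3 → ℝ) := basedFn_zero_left L p hp1 hp2
  have hrel : ‖relLinkVec L Uw‖ ≤ ‖linkEmbed L (p.1 : Edge 3 L → Fin 3 → ℝ)‖ + (‖basedLin L p‖ * r + M * r ^ 2) := by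
    rw [hx]
    have h1 := hT (gnoParam L w) p (lt_of_le_of_lt hξr hrT) hpT
    rw [hfB0] at h1
    set y : LinkSpace L := basedFn L (gnoParam L w, p) with hy
    set x0 : LinkSpace L := linkEmbed L (p.1 : Edge 3 L → Fin 3 → ℝ) with hx0
    set Bξ : LinkSpace L := basedLin L p (gnoParam L w) with hBξ
    have h2 : ‖Bξ‖ ≤ ‖basedLin L p‖ * r := (ContinuousLinearMap.le_opNorm _ _).trans (mul_le_mul_of_nonneg_left hξr (norm_nonneg _))
    have h3 : M * ‖gnoParam L w‖ ^ 2 ≤ M * r ^ 2 := mul_le_mul_of_nonneg_left (pow_le_pow_left₀ (norm_nonneg _) hξr 2) hM0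
    have hdec : y = x0 + ((y - x0 - Bξ) + Bξ) := by abel
    have h4 : ‖y - x0 - Bξ‖ ≤ M * r ^ 2 := h1.trans h3
    calc ‖y‖ = ‖x0 + ((y - x0 - Bξ) + Bξ)‖ := by rw [← hdec]
      _ ≤ ‖x0‖ + (‖y - x0 - Bξ‖ + ‖Bξ‖) := (norm_add_le _ _).trans (add_le_add le_rfl (norm_add_le _ _))
      _ ≤ ‖x0‖ + (M * r ^ 2 + ‖basedLin L p‖ * r) := by linarith
      _ = _ := by ring
  exact ⟨hfat, htube, hk, hS, hrel⟩

end Summit.QuantumFields.YangMills.Theorems.FemtoTransferGap.TwoLattice.ConstTube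

end
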